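import Mathlib
import HarnessLib

/-!
# Venture HSemireg — defect-free classes act on potentials («Lemma A» of TH3-W3-TANGENT §4)

HONEST FRAMING. Lean leaf for the computation cell `pub-hsemireg` (theory seat th-3 gen 31; file of
record `run/shared/lean/pub/pub-hsemireg/theory/TH3-W3-TANGENT.md` §4, 2026-08-24). In the minimal
twisted-complex model of a «reduced-point complex» on a smooth threefold germ, a W-class has three
even components `B₁ B₂ B₃` and odd potentials `V₁ V₂ V₃` tied to the three odd gluing operators
`u₁ u₂ u₃` by the Killing relations (E1) `uₗ Vⱼ + Vⱼ uₗ = ε_{jli} Bᵢ`. A class `e = (e₁,e₂,e₃)` is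
DEFECT-FREE when every `eᵢ` commutes with every `uₗ`; such classes are exactly the weight-one parts
of translation multiples `Σᵢ τᵢ·eᵢ` of endomorphism classes. LEMMA A of the note: for a defect-free
`e` and ANY class `B'` with potentials `V'`, the cross product `e × B'` is a GRADIENT — explicitly
`(e × B')ₗ = {uₗ, y}` with the single potential `y = -(e₁V'₁ + e₂V'₂ + e₃V'₃)` — hence exact in
`Ext²`, hence (by the (E2)-pairing identity of the criterion lemma, TH3-SIGMA-ORBIT-PROOF §8.3)
`str T(e, B', B'') = 0` for every third class `B''`: defect-free classes drop out of the conjecture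
(W³), which thereby reduces to the quotient of the weight-one socle by its defect-free part.
THIS FILE kernel-checks the operator identity behind Lemma A, one direction `l` at a time (the
other two are the same statement with the indices cycled): it needs only that `e₁ e₂ e₃` commute
with the ONE operator `uₗ` and the three (E1) relations in direction `l`. Every ring, no parity or
finiteness hypothesis. The model, the classes, exactness in `Ext²` and the reduction of (W³) are
NOT formalised; no object is constructed; nothing here bears on HC, HC_CM or HC_AV.
-/

namespace Summit.Ventures.HSemireg

/-- **Defect-free classes act on potentials (direction 1).** In any ring: if `e₁ e₂ e₃` commute
with `u` and the potentials satisfy the direction-1 Killing relations `u V₁ + V₁ u = 0`,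
`u V₂ + V₂ u = -B₃`, `u V₃ + V₃ u = B₂` (i.e. `{u₁,Vⱼ} = ε_{j1i} Bᵢ`), then the single odd
element `y = -(e₁ V₁ + e₂ V₂ + e₃ V₃)` has `u y + y u = e₂ B₃ - e₃ B₂ = (e × B)₁`.
(TH3-W3-TANGENT §4, Lemma A (i).) [folklore] -/
theorem anticomm_defectFree_potential {R : Type*} [Ring R]
    (u e₁ e₂ e₃ V₁ V₂ V₃ B₂ B₃ : R)
    (h₁ : e₁ * u = u * e₁) (h₂ : e₂ * u = u * e₂) (h₃ : e₃ * u = u * e₃)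
    (k₁ : u * V₁ + V₁ * u = 0) (k₂ : u * V₂ + V₂ * u = -B₃) (k₃ : u * V₃ + V₃ * u = B₂) :
    u * (-(e₁ * V₁ + e₂ * V₂ + e₃ * V₃)) + (-(e₁ * V₁ + e₂ * V₂ + e₃ * V₃)) * u
      = e₂ * B₃ - e₃ * B₂ := by
  -- move `u` past each `eⱼ`, then use the Killing relations
  have s₁ : u * (e₁ * V₁) + e₁ * V₁ * u = e₁ * (u * V₁ + V₁ * u) := by
    rw [← mul_assoc, ← h₁]; noncomm_ring
  have s₂ : u * (e₂ * V₂) + e₂ * V₂ * u = e₂ * (u * V₂ + V₂ * u) := by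
    rw [← mul_assoc, ← h₂]; noncomm_ring
  have s₃ : u * (e₃ * V₃) + e₃ * V₃ * u = e₃ * (u * V₃ + V₃ * u) := by
    rw [← mul_assoc, ← h₃]; noncomm_ring
  have expand : u * (-(e₁ * V₁ + e₂ * V₂ + e₃ * V₃)) + (-(e₁ * V₁ + e₂ * V₂ + e₃ * V₃)) * u
      = -((u * (e₁ * V₁) + e₁ * V₁ * u) + (u * (e₂ * V₂) + e₂ * V₂ * u)
          + (u * (e₃ * V₃) + e₃ * V₃ * u)) := by noncomm_ring
  rw [expand, s₁, s₂, s₃, k₁, k₂, k₃]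
  noncomm_ring

/-- **Defect-free classes act on potentials (all three directions).** In any ring: if every `eᵢ`
commutes with every `uₗ` and `V₁ V₂ V₃` are potentials of the class `(B₁,B₂,B₃)`, i.e. the nine
Killing relations `{uₗ,Vⱼ} = ε_{jli} Bᵢ` hold (`{uₗ,Vₗ} = 0`, `{u₁,V₂} = -B₃`, `{u₁,V₃} = B₂`,
`{u₂,V₃} = -B₁`, `{u₂,V₁} = B₃`, `{u₃,V₁} = -B₂`, `{u₃,V₂} = B₁`), then the one potential
`y = -(e₁V₁ + e₂V₂ + e₃V₃)` is a gradient witness for the whole cross product: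
`{u₁,y} = e₂B₃ - e₃B₂`, `{u₂,y} = e₃B₁ - e₁B₃`, `{u₃,y} = e₁B₂ - e₂B₁`.
So `e × B` is exact in the model's `Ext²` for every defect-free `e` and every class `B`.
(TH3-W3-TANGENT §4, Lemma A (i).) [folklore] -/
theorem cross_defectFree_eq_grad {R : Type*} [Ring R]
    (u₁ u₂ u₃ e₁ e₂ e₃ V₁ V₂ V₃ B₁ B₂ B₃ : R)
    (h₁₁ : e₁ * u₁ = u₁ * e₁) (h₂₁ : e₂ * u₁ = u₁ * e₂) (h₃₁ : e₃ * u₁ = u₁ * e₃)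
    (h₁₂ : e₁ * u₂ = u₂ * e₁) (h₂₂ : e₂ * u₂ = u₂ * e₂) (h₃₂ : e₃ * u₂ = u₂ * e₃)
    (h₁₃ : e₁ * u₃ = u₃ * e₁) (h₂₃ : e₂ * u₃ = u₃ * e₂) (h₃₃ : e₃ * u₃ = u₃ * e₃)
    (k₁₁ : u₁ * V₁ + V₁ * u₁ = 0) (k₁₂ : u₁ * V₂ + V₂ * u₁ = -B₃) (k₁₃ : u₁ * V₃ + V₃ * u₁ = B₂)
    (k₂₂ : u₂ * V₂ + V₂ * u₂ = 0) (k₂₃ : u₂ * V₃ + V₃ * u₂ = -B₁) (k₂₁ : u₂ * V₁ + V₁ * u₂ = B₃)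
    (k₃₃ : u₃ * V₃ + V₃ * u₃ = 0) (k₃₁ : u₃ * V₁ + V₁ * u₃ = -B₂) (k₃₂ : u₃ * V₂ + V₂ * u₃ = B₁) :
    (u₁ * (-(e₁ * V₁ + e₂ * V₂ + e₃ * V₃)) + (-(e₁ * V₁ + e₂ * V₂ + e₃ * V₃)) * u₁
        = e₂ * B₃ - e₃ * B₂) ∧
    (u₂ * (-(e₁ * V₁ + e₂ * V₂ + e₃ * V₃)) + (-(e₁ * V₁ + e₂ * V₂ + e₃ * V₃)) * u₂
        = e₃ * B₁ - e₁ * B₃) ∧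
    (u₃ * (-(e₁ * V₁ + e₂ * V₂ + e₃ * V₃)) + (-(e₁ * V₁ + e₂ * V₂ + e₃ * V₃)) * u₃
        = e₁ * B₂ - e₂ * B₁) := by
  refine ⟨anticomm_defectFree_potential u₁ e₁ e₂ e₃ V₁ V₂ V₃ B₂ B₃ h₁₁ h₂₁ h₃₁ k₁₁ k₁₂ k₁₃, ?_, ?_⟩
  · -- direction 2: cycle (1,2,3) → (2,3,1): the roles of (V₁,V₂,V₃) become (V₂,V₃,V₁)
    have h := anticomm_defectFree_potential u₂ e₂ e₃ e₁ V₂ V₃ V₁ B₃ B₁ h₂₂ h₃₂ h₁₂ k₂₂ k₂₃ k₂₁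
    have e : -(e₁ * V₁ + e₂ * V₂ + e₃ * V₃) = -(e₂ * V₂ + e₃ * V₃ + e₁ * V₁) := by abel
    rw [e]; exact h
  · have h := anticomm_defectFree_potential u₃ e₃ e₁ e₂ V₃ V₁ V₂ B₁ B₂ h₃₃ h₁₃ h₂₃ k₃₃ k₃₁ k₃₂
    have e : -(e₁ * V₁ + e₂ * V₂ + e₃ * V₃) = -(e₃ * V₃ + e₁ * V₁ + e₂ * V₂) := by abel
    rw [e]; exact h

end Summit.Ventures.HSemireg
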